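import Summits.QuantumFields.BalabanUV.Beta.CombMixedT2EvenStoreyTwoTorus

/-!
# `BalabanUV.Beta.CombMixedT2EvenStoreyTwoTorusRow` — binder row D1 ∕ (C1), PART 31d: **(K2b) AT DEPTH 2 ON THE TORUS, STOREYWISE — THE MATRIX ROW** (road FP's `hK2b` LEFT
# side of `TowerHN2RowMixedWard` at the depth-2 even composite mixed member, any box `M = Lc²·M′`, along any torus gauge function `λ`):
# `Σ_b (Dλ)_b • ℳ̂₂ᵉ^{b,β}|ff = wM2 • ( Σ_{b₁,b₂ ∈ win β} ((Λ b₂ − Λ b₁)·h(β;b₁,b₂)) • (ℓ̃_{b₁} ⊗ ℓ̃_{b₂}) + Σ_{b ∈ win β} ℓ(β;b) • (Ĥ_b·E_λ − E_λ·Ĥ_b) )`,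
# `Λ b := λ(ŵ(Lc•b.2 + ρ_c))` (the gauge function SAMPLED AT THE ROOT of the level-1 block), `ℓ̃_b f := Σ'_n ℓ(b;(f.2, ↑f.1 + M∘n))` (fine-slot-periodised transport),
# `Ĥ_b := (perF M (dper M (symHessFFAt ρ_c Lc b.1 b.2)))|ff` (PART 26's `Ĥ` one storey down), `E_λ := diagonal (λ ∘ fst)` — the two-storey word of J-NOTE-14 (Engine C TIER V-A
# `γ = −1` by value, PART 30 by kernel on the lattice) replacing v6's single commutator `κ₂ • [E_λ, Ĉ_β]`, which is NOT what holds at depth 2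

WHY (road FP g46 A-3 «storeywise RESHAPE WANTED» → v7; J-NOTE-14 §2∕§5).  PART 31c is the entrywise identity along the indicator gauges `δ_s`; here §8 sums it against `λ`
(`Σ_s δ_s(r)·λ s = λ(ŵ r)`, `TorusGaugeCovariancePairing.sum_tdelta_mul`) and packages both as matrix identities on the `ff` block in PART 26∕27's letters
(`perF ∘ dper`, `submatrix (·, inl ·)`, `Matrix.diagonal`, `Matrix.vecMulVec` for the rank-one top word).  In the tower: `L₂ := Lc²`, `j := 0` (`wM2 = 1`), `compMix (ctrOff 4 Lc) Lc 2 =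
(tabsComp 2 hLc (Roots.ctr Lc).hr cM).mixFF` by `tabsComp_mixFF ∕ Roots.ctr_r` (`rfl`), `M := towerTorus …`, `M′ :=` the coarse box.

WHAT ([folklore] finite-sum ∕ `Matrix` bookkeeping BY NAME; no `def`, no `def … : Prop`, nothing cited, 0 sorry): **`sum_Dlam_mul_perZ_dper_compMixedT2per_even`** (entrywise along `λ`),
**`torus_compM2even_pureGauge_fst`** (matrix form, gauge parameter `s`, `E_s := diagonal (δ_s ∘ fst)`), **`torus_compM2even_pureGauge_fst_fun`** (matrix form along `λ`).
WHAT THIS IS NOT: not v7's displayed row nor its junction with (K1′)∕(J-ΛS)∕the lock (the road's PART 3c∕v7; the row's PART 28∕29 give (K1′) and the fold); not the reading of the top word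
as `L̂ᵀ[Ĥ⁽¹⁾_β, E_Λ]L̂` over a level-1 torus (equivalent, not needed: the finite window of `β` is the natural level-1 index set); not depth ≥ 3; nothing of Bałaban's asserted, valued or
discharged; 0 estimates; 0∕4 row-D1 binders (hW, hR, D1Tel, D1Rep); ROOT M‴ p325680 ∕ P5c ∕ D6 untouched; NOT (C1), NOT (T-ID), NOT D1, NEVER «G-an2-4 closed», NOT BetaPertH,
NOT continuum, NOT Clay.

HONEST DEPENDENCY (page 1, mandatory): continuum YM on T⁴ ⇐ BetaPertH ∧ nine spine estimates (0/9 proved); BetaPertH ⇐ (D1) ∧ (D4) ∧ CAP+tail;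
G-an2-4 gates asym, D1 and NE2/3/4.  HONEST FRAMING (cell contract, verbatim): «discharging `BetaPertH` makes Bałaban's UV stability UNCONDITIONAL —
a real constructive-QFT result; it is NOT the continuum limit and NOT the Clay problem.»  ABSOLUTE RULE (cell charter, verbatim): «No internally-minted
statement may enter as a cited fact. Every hypothesis is either kernel-proved in this package or a verbatim quotation of a PUBLISHED theorem with page
reference. The manuscript(s) under audit are NOT citable for their own disputed steps — they are the thing under adjudication; programme-internal
(2001/route/tribunal) claims are never citable.»  Row D1 ∕ (C1) OWNER an2 (b2b-balaban-beta-an2) gen 71, 2026-08-28.  §8 shaped on PART 26 §3.  No existing file touched.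
-/

noncomputable section

open scoped BigOperators

namespace Summit.QuantumFields.BalabanUV.Beta.CombMixedT2EvenStoreyTwoTorusRow

open Finset Matrix
open Literature.MathematicalPhysics.QuantumFieldTheory
open Literature.MathematicalPhysics.QuantumFieldTheory.Balaban1983to89
open Literature.MathematicalPhysics.QuantumFieldTheory.Balaban1983to89.Beta
open B4TorusKernel.MultiPeriod (translate)
open B6Lemma24Torus (pbox)
open ExpKernelCalculus (MKer)
open AffineAveraging (Site)
open AveragingContoursRooted (ctr ctrOff)
open OneStepResolventKernel (Fib)
open BalabanStepW2 (M2Of wM2)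
open Summit.QuantumFields.BalabanUV.Beta.TameKernelCalculus (trK)
open Summit.QuantumFields.BalabanUV.Beta.BorderedHessian (sgnK)
open Summit.QuantumFields.BalabanUV.Beta.SymAveragingHessianCounts (symLinKerAt symHessKerAt symHessFFAt)
open Summit.QuantumFields.BalabanUV.Beta.CompositeVertexKernelRec (offs)
open Summit.QuantumFields.BalabanUV.Beta.CompositeOneShotJets (compMix)
open Summit.QuantumFields.BalabanUV.Beta.FP.KernelPeriodisationFib (Idx perF perF_apply perZ)
open Summit.QuantumFields.BalabanUV.Beta.FP.KernelPeriodisationFibLoc (dper)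
open Summit.QuantumFields.BalabanUV.Beta.FP.TorusGaugeCovariance (tdelta tgrad)
open Summit.QuantumFields.BalabanUV.Beta.FP.TorusGaugeCovariancePairing (sum_tdelta_mul wrapPt wrapPt_of_mem)
open Summit.QuantumFields.BalabanUV.Beta.CombMixedT2EvenStoreyTwoTorus (sum_push4 sum_push2 sum_tgrad_mul_perZ_dper_compMixedT2per_even)

variable {Lc : ℕ} [NeZero Lc]

/-! ## §8 Along a torus gauge FUNCTION; the two matrix forms of (K2b) at depth 2 (road FP's `hK2b` left side, storeywise right side) -/

section Row

variable {M M' : Fin (3 + 1) → ℕ} [∀ μ, NeZero (M μ)] [∀ μ, NeZero (M' μ)] (L₂ j : ℕ) (ρ' : Fin (3 + 1)) (w : Site (3 + 1))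
  {V : Fin (3 + 1) → Site (3 + 1) → MKer (3 + 1) (Fib 3)}

/-- [folklore] **`sum_Dlam_mul_perZ_dper_compMixedT2per_even` — ENTRYWISE ALONG ANY TORUS GAUGE FUNCTION** `λ : pbox M → ℝ` (`(Dλ)_{(u,κ)} := Σ_s tgrad M (u, inl κ) s·λ s`):
`Σ_{u,κ} (Dλ)_{(u,κ)} · perZ M (dper M (V κ u)) x z (inl α) (inl γ) = wM2 L₂ j · ( Σ⁴ (λ(ŵ(Lc•(Lc•w+e₂)+ρ_c)) − λ(ŵ(Lc•(Lc•w+e₁)+ρ_c)))·h·ℓ̃₁(x)·ℓ̃₂(z) + (λ(ŵ z) − λ(ŵ x))·Σ² ℓ·Ĥ_b(x,z) )`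
(`ŵ := wrapPt M`; PART 31c's indicator row summed against `λ`, `Σ_s δ_s(r)·λ s = λ(ŵ r)`). -/
theorem sum_Dlam_mul_perZ_dper_compMixedT2per_even (hM : ∀ i, M i = Lc ^ 2 * M' i)
    (hV : V = fun κ u x z a c => ∑' n : Site (3 + 1),
      ((1 / 2 : ℝ) • (M2Of 3 L₂ (compMix (ctrOff (3 + 1) Lc) Lc 2) j κ u ρ' (translate M' w n)
          + sgnK (trK (M2Of 3 L₂ (compMix (ctrOff (3 + 1) Lc) Lc 2) j κ u ρ' (translate M' w n))))) x z a c)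
    (lam : ↥(pbox M) → ℝ) (x z : Site (3 + 1)) (α γ : Fin (3 + 1)) :
    ∑ u : ↥(pbox M), ∑ κ : Fin (3 + 1), (∑ s : ↥(pbox M), tgrad M (u, Sum.inl κ) s * lam s) * perZ M (dper M (V κ (u : Site (3 + 1)))) x z (Sum.inl α) (Sum.inl γ)
      = wM2 3 L₂ j * ((∑ κ₁ : Fin (3 + 1), ∑ e₁ ∈ offs Lc, ∑ κ₂ : Fin (3 + 1), ∑ e₂ ∈ offs Lc,
          (lam (wrapPt M ((Lc : ℤ) • ((Lc : ℤ) • w + e₂) + ctr 4 Lc)) - lam (wrapPt M ((Lc : ℤ) • ((Lc : ℤ) • w + e₁) + ctr 4 Lc)))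
            * symHessKerAt (ctr 4 Lc) Lc ρ' w (κ₁, (Lc : ℤ) • w + e₁) (κ₂, (Lc : ℤ) • w + e₂)
            * (∑' n : Site (3 + 1), symLinKerAt (ctr 4 Lc) Lc κ₁ ((Lc : ℤ) • w + e₁) (α, translate M x n))
            * (∑' n : Site (3 + 1), symLinKerAt (ctr 4 Lc) Lc κ₂ ((Lc : ℤ) • w + e₂) (γ, translate M z n)))
        + (lam (wrapPt M z) - lam (wrapPt M x)) * ∑ κ : Fin (3 + 1), ∑ e ∈ offs Lc,
            symLinKerAt (ctr 4 Lc) Lc ρ' w (κ, (Lc : ℤ) • w + e) * perZ M (dper M (symHessFFAt (ctr 4 Lc) Lc κ ((Lc : ℤ) • w + e))) x z (Sum.inl α) (Sum.inl γ)) := by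
  -- the gauge function is a superposition of indicators
  have h1 : (∑ u : ↥(pbox M), ∑ κ : Fin (3 + 1), (∑ s : ↥(pbox M), tgrad M (u, Sum.inl κ) s * lam s)
        * perZ M (dper M (V κ (u : Site (3 + 1)))) x z (Sum.inl α) (Sum.inl γ))
      = ∑ s : ↥(pbox M), lam s * ∑ u : ↥(pbox M), ∑ κ : Fin (3 + 1), tgrad M (u, Sum.inl κ) s * perZ M (dper M (V κ (u : Site (3 + 1)))) x z (Sum.inl α) (Sum.inl γ) := by
    simp only [Finset.mul_sum, Finset.sum_mul]
    exact (Finset.sum_congr rfl fun u _ => Finset.sum_comm).trans (Finset.sum_comm.trans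
      (Finset.sum_congr rfl fun s _ => Finset.sum_congr rfl fun u _ => Finset.sum_congr rfl fun κ _ => by ring))
  rw [h1, Finset.sum_congr rfl fun s _ => by rw [sum_tgrad_mul_perZ_dper_compMixedT2per_even L₂ j ρ' w hM hV s x z α γ]]
  -- both sides are the same superposition: expand `λ(ŵ r) = Σ_s δ_s(r)·λ s` on the right
  rw [Finset.sum_congr rfl fun κ₁ _ => Finset.sum_congr rfl fun e₁ _ => Finset.sum_congr rfl fun κ₂ _ => Finset.sum_congr rfl fun e₂ _ =>
      show (lam (wrapPt M ((Lc : ℤ) • ((Lc : ℤ) • w + e₂) + ctr 4 Lc)) - lam (wrapPt M ((Lc : ℤ) • ((Lc : ℤ) • w + e₁) + ctr 4 Lc)))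
            * symHessKerAt (ctr 4 Lc) Lc ρ' w (κ₁, (Lc : ℤ) • w + e₁) (κ₂, (Lc : ℤ) • w + e₂)
            * (∑' n : Site (3 + 1), symLinKerAt (ctr 4 Lc) Lc κ₁ ((Lc : ℤ) • w + e₁) (α, translate M x n))
            * (∑' n : Site (3 + 1), symLinKerAt (ctr 4 Lc) Lc κ₂ ((Lc : ℤ) • w + e₂) (γ, translate M z n))
        = ∑ s : ↥(pbox M), lam s * ((tdelta M ((Lc : ℤ) • ((Lc : ℤ) • w + e₂) + ctr 4 Lc) s - tdelta M ((Lc : ℤ) • ((Lc : ℤ) • w + e₁) + ctr 4 Lc) s)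
            * symHessKerAt (ctr 4 Lc) Lc ρ' w (κ₁, (Lc : ℤ) • w + e₁) (κ₂, (Lc : ℤ) • w + e₂)
            * (∑' n : Site (3 + 1), symLinKerAt (ctr 4 Lc) Lc κ₁ ((Lc : ℤ) • w + e₁) (α, translate M x n))
            * (∑' n : Site (3 + 1), symLinKerAt (ctr 4 Lc) Lc κ₂ ((Lc : ℤ) • w + e₂) (γ, translate M z n))) by
        rw [← sum_tdelta_mul (M := M) ((Lc : ℤ) • ((Lc : ℤ) • w + e₂) + ctr 4 Lc) lam, ← sum_tdelta_mul (M := M) ((Lc : ℤ) • ((Lc : ℤ) • w + e₁) + ctr 4 Lc) lam,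
          ← Finset.sum_sub_distrib, Finset.sum_mul, Finset.sum_mul, Finset.sum_mul]
        exact Finset.sum_congr rfl fun s _ => by ring,
    show lam (wrapPt M z) - lam (wrapPt M x) = ∑ s : ↥(pbox M), lam s * (tdelta M z s - tdelta M x s) by
      rw [← sum_tdelta_mul (M := M) z lam, ← sum_tdelta_mul (M := M) x lam, ← Finset.sum_sub_distrib]
      exact Finset.sum_congr rfl fun s _ => by ring]
  simp only [Finset.mul_sum, Finset.sum_mul, mul_add, Finset.sum_add_distrib]
  rw [sum_push4 (Finset.univ : Finset ↥(pbox M)), sum_push2 (Finset.univ : Finset ↥(pbox M))]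
  exact congrArg₂ (· + ·)
    (Finset.sum_congr rfl fun κ₁ _ => Finset.sum_congr rfl fun e₁ _ => Finset.sum_congr rfl fun κ₂ _ => Finset.sum_congr rfl fun e₂ _ =>
      Finset.sum_congr rfl fun s _ => by ring)
    (Finset.sum_congr rfl fun κ _ => Finset.sum_congr rfl fun e _ => Finset.sum_congr rfl fun s _ => by ring)

/-- [folklore] **`torus_compM2even_pureGauge_fst` — MATRIX FORM ON THE `ff` BLOCK, ANY BOX `M = Lc²·M′`** ((K2b) at depth 2, STOREYWISE): with the torus even composite mixed
bi-member `ℳ₂ᵉ^{b,β} := (perF M (dper M (V b.2 ↑b.1)))|ff` (fine field bond `b` on the torus of `M`; coarse multiplier bond `β = (ρ′, w)` at level 2, its COARSE-period copies summed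
inside `V`), for every torus gauge parameter `s`:
`Σ_b tgrad M (b.1, inl b.2) s • ℳ₂ᵉ^{b,β} = wM2 L₂ j • ( Σ_{b₁,b₂ ∈ win β} ((δ_s(root b₂) − δ_s(root b₁))·h(β;b₁,b₂)) • (ℓ̃_{b₁} ⊗ ℓ̃_{b₂}) + Σ_{b ∈ win β} ℓ(β;b) • (Ĥ_b E_s − E_s Ĥ_b) )`,
`ℓ̃_b f := Σ'_n ℓ(b;(f.2, ↑f.1 + M∘n))` (the fine-slot-periodised transport), `Ĥ_b := (perF M (dper M (symHessFFAt ρ_c Lc b.1 b.2)))|ff` (the periodised level-0 Hessian brick of the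
level-1 window bond `b` — PART 26's `Ĥ` one storey down), `E_s := diagonal (δ_s ∘ fst)`: TOP storey = the level-1 brick's commutator with the ROOT-sampled indicator transported to the
fine torus; LOWER storey = the finest commutators weighted by the level-1 linear brick. NOT the single commutator `[E_s, Ĉ_β]` with the periodised composite Hessian. -/
theorem torus_compM2even_pureGauge_fst (hM : ∀ i, M i = Lc ^ 2 * M' i)
    (hV : V = fun κ u x z a c => ∑' n : Site (3 + 1),
      ((1 / 2 : ℝ) • (M2Of 3 L₂ (compMix (ctrOff (3 + 1) Lc) Lc 2) j κ u ρ' (translate M' w n)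
          + sgnK (trK (M2Of 3 L₂ (compMix (ctrOff (3 + 1) Lc) Lc 2) j κ u ρ' (translate M' w n))))) x z a c)
    (s : ↥(pbox M)) :
    (∑ b : ↥(pbox M) × Fin (3 + 1), tgrad M (b.1, Sum.inl b.2) s •
        (perF M (dper M (V b.2 (b.1 : Site (3 + 1))))).submatrix
          (fun b : ↥(pbox M) × Fin (3 + 1) => ((b.1, Sum.inl b.2) : Idx M (Fib 3)))
          (fun b : ↥(pbox M) × Fin (3 + 1) => ((b.1, Sum.inl b.2) : Idx M (Fib 3))))
      = wM2 3 L₂ j • ((∑ κ₁ : Fin (3 + 1), ∑ e₁ ∈ offs Lc, ∑ κ₂ : Fin (3 + 1), ∑ e₂ ∈ offs Lc,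
            ((tdelta M ((Lc : ℤ) • ((Lc : ℤ) • w + e₂) + ctr 4 Lc) s - tdelta M ((Lc : ℤ) • ((Lc : ℤ) • w + e₁) + ctr 4 Lc) s)
              * symHessKerAt (ctr 4 Lc) Lc ρ' w (κ₁, (Lc : ℤ) • w + e₁) (κ₂, (Lc : ℤ) • w + e₂))
            • Matrix.vecMulVec
                (fun f : ↥(pbox M) × Fin (3 + 1) => ∑' n : Site (3 + 1), symLinKerAt (ctr 4 Lc) Lc κ₁ ((Lc : ℤ) • w + e₁) (f.2, translate M (f.1 : Site (3 + 1)) n))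
                (fun f : ↥(pbox M) × Fin (3 + 1) => ∑' n : Site (3 + 1), symLinKerAt (ctr 4 Lc) Lc κ₂ ((Lc : ℤ) • w + e₂) (f.2, translate M (f.1 : Site (3 + 1)) n)))
        + ∑ κ : Fin (3 + 1), ∑ e ∈ offs Lc, symLinKerAt (ctr 4 Lc) Lc ρ' w (κ, (Lc : ℤ) • w + e) •
            ((perF M (dper M (symHessFFAt (ctr 4 Lc) Lc κ ((Lc : ℤ) • w + e)))).submatrix
                (fun b : ↥(pbox M) × Fin (3 + 1) => ((b.1, Sum.inl b.2) : Idx M (Fib 3)))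
                (fun b : ↥(pbox M) × Fin (3 + 1) => ((b.1, Sum.inl b.2) : Idx M (Fib 3)))
              * Matrix.diagonal (fun b : ↥(pbox M) × Fin (3 + 1) => tdelta M (b.1 : Site (3 + 1)) s)
            - Matrix.diagonal (fun b : ↥(pbox M) × Fin (3 + 1) => tdelta M (b.1 : Site (3 + 1)) s)
              * (perF M (dper M (symHessFFAt (ctr 4 Lc) Lc κ ((Lc : ℤ) • w + e)))).submatrix
                (fun b : ↥(pbox M) × Fin (3 + 1) => ((b.1, Sum.inl b.2) : Idx M (Fib 3)))
                (fun b : ↥(pbox M) × Fin (3 + 1) => ((b.1, Sum.inl b.2) : Idx M (Fib 3))))) := by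
  ext f f'
  simp only [Matrix.sum_apply, Matrix.smul_apply, Matrix.add_apply, Matrix.sub_apply, Matrix.vecMulVec_apply, Matrix.mul_diagonal, Matrix.diagonal_mul,
    Matrix.submatrix_apply, perF_apply, smul_eq_mul]
  rw [Fintype.sum_prod_type, sum_tgrad_mul_perZ_dper_compMixedT2per_even L₂ j ρ' w hM hV s _ _ f.2 f'.2]
  refine congrArg (fun t : ℝ => wM2 3 L₂ j * t) (congrArg₂ (· + ·) ?_ ?_)
  · exact Finset.sum_congr rfl fun κ₁ _ => Finset.sum_congr rfl fun e₁ _ => Finset.sum_congr rfl fun κ₂ _ => Finset.sum_congr rfl fun e₂ _ => by ring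
  · rw [Finset.mul_sum]
    refine Finset.sum_congr rfl fun κ _ => ?_
    rw [Finset.mul_sum]
    exact Finset.sum_congr rfl fun e _ => by ring

/-- [folklore] **`torus_compM2even_pureGauge_fst_fun` — (K2b) AT DEPTH 2 ALONG ANY TORUS GAUGE FUNCTION, STOREYWISE** (`λ : pbox M → ℝ`, `(Dλ)_b := Σ_s tgrad M (b.1, inl b.2) s·λ s`,
`E_λ := diagonal (λ ∘ fst)`, `Λ(b) := λ(ŵ(Lc•b.2 + ρ_c))` the gauge function SAMPLED AT THE ROOT of the level-1 block `b`):
`Σ_b (Dλ)_b • ℳ₂ᵉ^{b,β} = wM2 L₂ j • ( Σ_{b₁,b₂ ∈ win β} ((Λ b₂ − Λ b₁)·h(β;b₁,b₂)) • (ℓ̃_{b₁} ⊗ ℓ̃_{b₂}) + Σ_{b ∈ win β} ℓ(β;b) • (Ĥ_b E_λ − E_λ Ĥ_b) )`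
— road FP's `hK2b` LEFT side (v6 `TowerHN2RowMixedWard`) at depth 2 with the torus even COMPOSITE mixed member; the RIGHT side is the two-storey word of J-NOTE-14 (Engine C TIER V-A
`γ = −1` by value; PART 30 by kernel on the lattice): `κ₂ • [E_λ, Ĉ_β]` is replaced by the top storey's `L̃ᵀ[Ĥ⁽¹⁾_β, E_Λ]L̃` (here with the finite window of `β` as the level-1 index
set: `Σ_{b₁b₂} (Λb₂ − Λb₁) h(β;b₁,b₂) ℓ̃_{b₁}⊗ℓ̃_{b₂}`) plus the lower storey's `Σ_b ℓ(β;b)•[Ĥ_b, E_λ]`. -/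
theorem torus_compM2even_pureGauge_fst_fun (hM : ∀ i, M i = Lc ^ 2 * M' i)
    (hV : V = fun κ u x z a c => ∑' n : Site (3 + 1),
      ((1 / 2 : ℝ) • (M2Of 3 L₂ (compMix (ctrOff (3 + 1) Lc) Lc 2) j κ u ρ' (translate M' w n)
          + sgnK (trK (M2Of 3 L₂ (compMix (ctrOff (3 + 1) Lc) Lc 2) j κ u ρ' (translate M' w n))))) x z a c)
    (lam : ↥(pbox M) → ℝ) :
    (∑ b : ↥(pbox M) × Fin (3 + 1), (∑ s : ↥(pbox M), tgrad M (b.1, Sum.inl b.2) s * lam s) •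
        (perF M (dper M (V b.2 (b.1 : Site (3 + 1))))).submatrix
          (fun b : ↥(pbox M) × Fin (3 + 1) => ((b.1, Sum.inl b.2) : Idx M (Fib 3)))
          (fun b : ↥(pbox M) × Fin (3 + 1) => ((b.1, Sum.inl b.2) : Idx M (Fib 3))))
      = wM2 3 L₂ j • ((∑ κ₁ : Fin (3 + 1), ∑ e₁ ∈ offs Lc, ∑ κ₂ : Fin (3 + 1), ∑ e₂ ∈ offs Lc,
            ((lam (wrapPt M ((Lc : ℤ) • ((Lc : ℤ) • w + e₂) + ctr 4 Lc)) - lam (wrapPt M ((Lc : ℤ) • ((Lc : ℤ) • w + e₁) + ctr 4 Lc)))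
              * symHessKerAt (ctr 4 Lc) Lc ρ' w (κ₁, (Lc : ℤ) • w + e₁) (κ₂, (Lc : ℤ) • w + e₂))
            • Matrix.vecMulVec
                (fun f : ↥(pbox M) × Fin (3 + 1) => ∑' n : Site (3 + 1), symLinKerAt (ctr 4 Lc) Lc κ₁ ((Lc : ℤ) • w + e₁) (f.2, translate M (f.1 : Site (3 + 1)) n))
                (fun f : ↥(pbox M) × Fin (3 + 1) => ∑' n : Site (3 + 1), symLinKerAt (ctr 4 Lc) Lc κ₂ ((Lc : ℤ) • w + e₂) (f.2, translate M (f.1 : Site (3 + 1)) n)))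
        + ∑ κ : Fin (3 + 1), ∑ e ∈ offs Lc, symLinKerAt (ctr 4 Lc) Lc ρ' w (κ, (Lc : ℤ) • w + e) •
            ((perF M (dper M (symHessFFAt (ctr 4 Lc) Lc κ ((Lc : ℤ) • w + e)))).submatrix
                (fun b : ↥(pbox M) × Fin (3 + 1) => ((b.1, Sum.inl b.2) : Idx M (Fib 3)))
                (fun b : ↥(pbox M) × Fin (3 + 1) => ((b.1, Sum.inl b.2) : Idx M (Fib 3)))
              * Matrix.diagonal (fun b : ↥(pbox M) × Fin (3 + 1) => lam b.1)
            - Matrix.diagonal (fun b : ↥(pbox M) × Fin (3 + 1) => lam b.1)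
              * (perF M (dper M (symHessFFAt (ctr 4 Lc) Lc κ ((Lc : ℤ) • w + e)))).submatrix
                (fun b : ↥(pbox M) × Fin (3 + 1) => ((b.1, Sum.inl b.2) : Idx M (Fib 3)))
                (fun b : ↥(pbox M) × Fin (3 + 1) => ((b.1, Sum.inl b.2) : Idx M (Fib 3))))) := by
  ext f f'
  simp only [Matrix.sum_apply, Matrix.smul_apply, Matrix.add_apply, Matrix.sub_apply, Matrix.vecMulVec_apply, Matrix.mul_diagonal, Matrix.diagonal_mul,
    Matrix.submatrix_apply, perF_apply, smul_eq_mul]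
  rw [Fintype.sum_prod_type, sum_Dlam_mul_perZ_dper_compMixedT2per_even L₂ j ρ' w hM hV lam _ _ f.2 f'.2, wrapPt_of_mem, wrapPt_of_mem]
  refine congrArg (fun t : ℝ => wM2 3 L₂ j * t) (congrArg₂ (· + ·) ?_ ?_)
  · exact Finset.sum_congr rfl fun κ₁ _ => Finset.sum_congr rfl fun e₁ _ => Finset.sum_congr rfl fun κ₂ _ => Finset.sum_congr rfl fun e₂ _ => by ring
  · rw [Finset.mul_sum]
    refine Finset.sum_congr rfl fun κ _ => ?_
    rw [Finset.mul_sum]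
    exact Finset.sum_congr rfl fun e _ => by ring

end Row

end Summit.QuantumFields.BalabanUV.Beta.CombMixedT2EvenStoreyTwoTorusRow

end
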